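import Summits.CriticalPhenomena.PercolationContinuityZ3.Theorems.PercNearOneGluingNoHeavyPcintLoopExclusionFirstRungs
import Literature.Probability.RandomPlanarGeometry.SAWFisherSykesBound
import HarnessLib

/-!
# CriticalPhenomena/PercolationContinuityZ3 — Theorems/PercNearOneGluingNoHeavyPcintMemoryFourRecursion.lean: the EXACT Fisher–Sykes recursion for memory-4 walks (lower inequalities by injective continuations) and `memWords d 4 = memFourWords`

Lane prim-pcint, STRUCTURE rule; lemma file for …PcintMemoryFourFisherSykes (`μ_4(d)` IS the Fisher–Sykes root).  The tree's
Literature file `SAWFisherSykesBound` has the three end classes `A` (straight), `B` (turn, not a U-turn), `C` (U-turn) of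
memory-4 words with the UPPER count recursion; here:

* `stepVec_apply`, `stepVec_dotProduct*`, **`cancel_of_three_steps`** (`e_a + e_b + e_c = e_e` ⇒ `b = −a ∨ c = −b ∨ c = −a`,
  via `‖a+b+c‖² = 3 + 2(ab+bc+ca)`), `wordPos_ne_of_odd` (parity) — also used by …PcintNawMemoryThree;
* `isMemFour_wordSnoc` (appending an admissible step), `card_endABC_eq` (the classes PARTITION), and the LOWER recursion
  `card_memFourWords_le_card_endA_succ` (`A' ≥ A + B + C`), `card_endB_le_card_endC_succ` (`C' ≥ B`), `turnCont` /
  `le_card_turnCont` / `le_card_endB_succ` (`B' ≥ (2d−2)A + (2d−3)(B + C)`) — so the Fisher–Sykes recursion holds with EQUALITY;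
* `isMem_four_of_isMemFour`, **`memWords_four_eq_memFourWords`**, `memCount_four_eq`: memory `4` of the typed hierarchy
  (…PcintMemoryTailLaw) IS `IsMemFour` (a gap-4 return forces, by `cancel_of_three_steps`, a reversal or the unit square).

HONEST FRAMING: elementary combinatorics (Fisher–Sykes 1959, App. A; Madras–Slade (1.2.14)).  Written by prim-pcint-2 gen 16
(prover-prim-pcint-2-g16-0), 2026-08-24.
-/

noncomputable section

open Filter Topology Matrix
open Literature.Probability.LatticeModels Literature.Probability.Percolation
open Literature.Probability.RandomPlanarGeometry.SAW.Zd (endA endB endC EndTurn EndU card_memFourWords_le_endABC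
  card_endA_succ_le card_endB_succ_le card_endC_succ_le)
open Literature.Probability.FitznerVanDerHofstad2017 (wordSnoc wordSnoc_apply_of_lt wordSnoc_last wordInit_wordSnoc)
open Summit.CriticalPhenomena.PercolationContinuityZ3.Theorems.Pcint

namespace Summit.CriticalPhenomena.PercolationContinuityZ3.Theorems.Pcint.MemoryTail

variable {d : ℕ}

/-! ### Unit steps: coordinates, dot products, and the three-step cancellation lemma -/

/-- Coordinates of a unit step: `stepVec (j, s) i = if i = j then ±1 else 0`. [folklore] -/
theorem stepVec_apply (a : Fin d × Bool) (i : Fin d) :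
    stepVec a i = if i = a.1 then (if a.2 then 1 else -1) else 0 := by
  obtain ⟨j, s⟩ := a
  by_cases hij : i = j
  · subst hij; cases s <;> simp [stepVec]
  · cases s <;> simp [stepVec, hij]

/-- `stepVec a ⬝ᵥ v = ± v(a.1)`. [folklore] -/
theorem stepVec_dotProduct (a : Fin d × Bool) (v : Site d) :
    stepVec a ⬝ᵥ v = if a.2 then v a.1 else -v a.1 := by
  obtain ⟨j, s⟩ := a
  cases s <;> simp [stepVec, single_dotProduct, neg_dotProduct]

/-- `e_a · e_a = 1`. [folklore] -/
theorem stepVec_dotProduct_self (a : Fin d × Bool) : stepVec a ⬝ᵥ stepVec a = 1 := by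
  rw [stepVec_dotProduct, stepVec_apply]
  obtain ⟨j, s⟩ := a
  cases s <;> simp

/-- Two unit steps have dot product `≥ 0` unless one reverses the other. [folklore] -/
theorem stepVec_dotProduct_nonneg {a b : Fin d × Bool} (h : b ≠ srev a) : 0 ≤ stepVec a ⬝ᵥ stepVec b := by
  rw [stepVec_dotProduct, stepVec_apply]
  obtain ⟨i, s⟩ := a
  obtain ⟨j, t⟩ := b
  simp only [srev, ne_eq, Prod.mk.injEq, not_and] at h
  by_cases hij : i = j
  · subst hij
    have ht : t = s := by
      have := h rfl
      cases s <;> cases t <;> simp_all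
    subst ht
    cases t <;> simp
  · cases s <;> simp [hij]

/-- **Three unit steps sum to a unit step only with a cancellation** (`‖a+b+c‖² = 3 + 2(ab+bc+ca) = 1` forces a negative
dot product): if `e_a + e_b + e_c = e_e` then `b = −a`, `c = −b` or `c = −a`. [folklore] -/
theorem cancel_of_three_steps {a b c e : Fin d × Bool}
    (h : stepVec a + stepVec b + stepVec c = stepVec e) : b = srev a ∨ c = srev b ∨ c = srev a := by
  by_contra hcon
  simp only [not_or] at hcon
  obtain ⟨hba, hcb, hca⟩ := hcon
  have hE := stepVec_dotProduct_self e
  rw [← h] at hE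
  simp only [add_dotProduct, dotProduct_add] at hE
  have haa := stepVec_dotProduct_self a
  have hbb := stepVec_dotProduct_self b
  have hcc := stepVec_dotProduct_self c
  have hab := stepVec_dotProduct_nonneg hba
  have hbc := stepVec_dotProduct_nonneg hcb
  have hac := stepVec_dotProduct_nonneg hca
  have hba' : 0 ≤ stepVec b ⬝ᵥ stepVec a := by rw [dotProduct_comm]; exact hab
  have hcb' : 0 ≤ stepVec c ⬝ᵥ stepVec b := by rw [dotProduct_comm]; exact hbc
  have hca' : 0 ≤ stepVec c ⬝ᵥ stepVec a := by rw [dotProduct_comm]; exact hac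
  linarith

/-- A step word never stands still: consecutive... odd gaps change the `ℓ¹` parity, so `ω(i) ≠ ω(j)` when `j − i` is odd. [folklore] -/
theorem wordPos_ne_of_odd {n : ℕ} (w : Fin n → Fin d × Bool) {i j : ℕ} (hi : i ≤ n) (hj : j ≤ n)
    (hij : (i + j) % 2 = 1) : wordPos w i ≠ wordPos w j := by
  intro heq
  have hpi := MemoryTail.l1_wordPos_mod_two w i hi
  have hpj := MemoryTail.l1_wordPos_mod_two w j hj
  rw [heq] at hpi
  omega


/-! ### Appending a step to a memory-4 word -/

/-- Appending `c` to a memory-4 word of length `n+3` keeps memory 4 iff `c` does not reverse the last step and does not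
close a unit square with the last three. [folklore] -/
theorem isMemFour_wordSnoc {n : ℕ} {u : Fin (n + 3) → Fin d × Bool} (hu : IsMemFour u) {c : Fin d × Bool}
    (hrev : c ≠ srev (u ⟨n + 2, by omega⟩))
    (hsq : ¬ (u ⟨n + 2, by omega⟩ = srev (u ⟨n, by omega⟩) ∧ c = srev (u ⟨n + 1, by omega⟩))) :
    IsMemFour (wordSnoc u c) := by
  have hlt : ∀ (k : ℕ) (hk : k < n + 3), wordSnoc u c ⟨k, by omega⟩ = u ⟨k, hk⟩ := fun k hk =>
    wordSnoc_apply_of_lt u c (show (⟨k, by omega⟩ : Fin (n + 3 + 1)).1 < n + 3 from hk)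
  have hlast : wordSnoc u c ⟨n + 3, by omega⟩ = c := wordSnoc_last u c
  refine ⟨fun k hk => ?_, fun k hk => ?_⟩
  · by_cases hk2 : k + 1 < n + 3
    · rw [hlt (k + 1) hk2, hlt k (by omega)]; exact hu.1 k hk2
    · have hk' : k = n + 2 := by omega
      subst hk'; rw [hlast, hlt (n + 2) (by omega)]; exact hrev
  · by_cases hk2 : k + 3 < n + 3
    · rw [hlt (k + 3) hk2, hlt (k + 2) (by omega), hlt (k + 1) (by omega), hlt k (by omega)]; exact hu.2 k hk2
    · have hk' : k = n := by omega
      subst hk'; rw [hlast, hlt (k + 2) (by omega), hlt (k + 1) (by omega), hlt k (by omega)]; exact hsq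

/-- `(u, c) ↦ wordSnoc u c` is injective (copy of the NAW-side lemma for this namespace). [folklore] -/
theorem wordSnoc_inj' {n : ℕ} {u u' : Fin n → Fin d × Bool} {c c' : Fin d × Bool} (h : wordSnoc u c = wordSnoc u' c') :
    u = u' ∧ c = c' := by
  constructor
  · have := congrArg Literature.Probability.Percolation.wordInit h
    simpa using this
  · have := congrFun h ⟨n, by omega⟩
    simpa using this

/-- Two steps on the same axis which are not reverse to each other are equal. [folklore] -/
theorem eq_of_fst_eq_of_ne_srev' {a b : Fin d × Bool} (h1 : a.1 = b.1) (h2 : a ≠ srev b) : a = b := by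
  obtain ⟨i, x⟩ := a
  obtain ⟨j, y⟩ := b
  simp only at h1
  subst h1
  simp only [srev, ne_eq, Prod.mk.injEq, true_and] at h2
  cases x <;> cases y <;> simp_all

/-- `#memFourWords (n+3) = A_n + B_n + C_n` (the three end classes partition). [folklore] -/
theorem card_endABC_eq (d n : ℕ) :
    (endA d n).card + (endB d n).card + (endC d n).card = (memFourWords d (n + 3)).card := by
  classical
  have hBC : (endB d n).card + (endC d n).card = ((memFourWords d (n + 3)).filter fun w => EndTurn w).card := by
    have h1 : endB d n = ((memFourWords d (n + 3)).filter fun w => EndTurn w).filter fun w => ¬ EndU w := by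
      ext w; simp [endB, Finset.mem_filter, and_assoc]
    have h2 : endC d n = ((memFourWords d (n + 3)).filter fun w => EndTurn w).filter fun w => EndU w := by
      ext w
      simp only [endC, Finset.mem_filter]
      constructor
      · rintro ⟨hm, hu⟩
        refine ⟨⟨hm, ?_⟩, hu⟩
        unfold EndTurn; rw [hu.2]; exact fun e => hu.1 (by simpa [srev] using e.symm)
      · rintro ⟨⟨hm, _⟩, hu⟩; exact ⟨hm, hu⟩
    rw [h1, h2, add_comm, Finset.card_filter_add_card_filter_not]
  have hA : endA d n = (memFourWords d (n + 3)).filter fun w => ¬ EndTurn w := rfl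
  rw [add_assoc, hBC, hA, add_comm, Finset.card_filter_add_card_filter_not]

/-- **`A_{n+1} ≥ A_n + B_n + C_n`** (repeat the last step). [folklore] -/
theorem card_memFourWords_le_card_endA_succ (d n : ℕ) :
    (memFourWords d (n + 3)).card ≤ (endA d (n + 1)).card := by
  classical
  refine Finset.card_le_card_of_injOn (fun u => wordSnoc u (u ⟨n + 2, by omega⟩)) (fun u hu => ?_)
    (fun u _ u' _ h => (wordSnoc_inj' h).1)
  rw [Finset.mem_coe, mem_memFourWords] at hu
  rw [Finset.mem_coe, endA, Finset.mem_filter, mem_memFourWords]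
  refine ⟨isMemFour_wordSnoc hu (Literature.Probability.Percolation.srev_ne_self _).symm ?_, ?_⟩
  · rintro ⟨h1, h2⟩
    -- u(n+2) = srev u(n) and u(n+2) = srev u(n+1) ⇒ u(n) = u(n+1), then u(n+2) = srev u(n+1): a reversal
    exact hu.1 (n + 1) (by omega) h2
  · unfold EndTurn
    intro h
    apply h
    beta_reduce
    rw [show (⟨n + 1 + 2, _⟩ : Fin (n + 1 + 3)) = ⟨n + 3, by omega⟩ from rfl, wordSnoc_last,
      wordSnoc_apply_of_lt u _ (show (⟨n + 1 + 1, by omega⟩ : Fin (n + 3 + 1)).1 < n + 3 by simp)]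

/-- **`C_{n+1} ≥ B_n`** (append the reverse of the second-to-last step: a U-turn). [folklore] -/
theorem card_endB_le_card_endC_succ (d n : ℕ) : (endB d n).card ≤ (endC d (n + 1)).card := by
  classical
  refine Finset.card_le_card_of_injOn (fun u => wordSnoc u (srev (u ⟨n + 1, by omega⟩))) (fun u hu => ?_)
    (fun u _ u' _ h => (wordSnoc_inj' h).1)
  rw [Finset.mem_coe, endB, Finset.mem_filter, mem_memFourWords] at hu
  obtain ⟨hm, ht, hnu⟩ := hu
  rw [Finset.mem_coe, endC, Finset.mem_filter, mem_memFourWords]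
  have hlt : ∀ (k : ℕ) (hk : k < n + 3), wordSnoc u (srev (u ⟨n + 1, by omega⟩)) ⟨k, by omega⟩ = u ⟨k, hk⟩ :=
    fun k hk => wordSnoc_apply_of_lt u _ (show (⟨k, by omega⟩ : Fin (n + 3 + 1)).1 < n + 3 from hk)
  refine ⟨isMemFour_wordSnoc hm ?_ ?_, ?_⟩
  · -- srev u(n+1) ≠ srev u(n+2) since the axes differ
    intro h
    have : u ⟨n + 1, by omega⟩ = u ⟨n + 2, by omega⟩ := by simpa using congrArg srev h
    exact ht (by rw [this])
  · rintro ⟨h1, -⟩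
    -- then u would end with a U-turn
    refine hnu ⟨?_, h1⟩
    intro e
    unfold EndTurn at ht
    rw [h1] at ht
    exact ht (by simpa [srev] using e.symm)
  · unfold EndU
    beta_reduce
    rw [show (⟨n + 1 + 2, _⟩ : Fin (n + 1 + 3)) = ⟨n + 3, by omega⟩ from rfl, wordSnoc_last,
      show (⟨n + 1 + 1, _⟩ : Fin (n + 1 + 3)) = ⟨n + 2, by omega⟩ from rfl, hlt (n + 2) (by omega),
      show (⟨n + 1, _⟩ : Fin (n + 1 + 3)) = ⟨n + 1, by omega⟩ from rfl, hlt (n + 1) (by omega)]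
    exact ⟨ht, rfl⟩

open Classical in
/-- `B_n + C_n = #{memory-4 words ending with a turn}`. [folklore] -/
theorem card_endB_add_card_endC (d n : ℕ) :
    (endB d n).card + (endC d n).card = ((memFourWords d (n + 3)).filter fun w => EndTurn w).card := by
  classical
  have h1 : endB d n = ((memFourWords d (n + 3)).filter fun w => EndTurn w).filter fun w => ¬ EndU w := by
    ext w; simp [endB, Finset.mem_filter, and_assoc]
  have h2 : endC d n = ((memFourWords d (n + 3)).filter fun w => EndTurn w).filter fun w => EndU w := by
    ext w
    simp only [endC, Finset.mem_filter]
    constructor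
    · rintro ⟨hm, hu⟩
      refine ⟨⟨hm, ?_⟩, hu⟩
      unfold EndTurn; rw [hu.2]; exact fun e => hu.1 (by simpa [srev] using e.symm)
    · rintro ⟨⟨hm, _⟩, hu⟩; exact ⟨hm, hu⟩
  rw [h1, h2, add_comm, Finset.card_filter_add_card_filter_not]

/-- The steps off a given axis number `2d − 2`. [folklore] -/
theorem card_filter_fst_ne' (i : Fin d) :
    ((Finset.univ : Finset (Fin d × Bool)).filter fun a => a.1 ≠ i).card = 2 * d - 2 := by
  classical
  have : ((Finset.univ : Finset (Fin d × Bool)).filter fun a => a.1 ≠ i) =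
      (Finset.univ.erase i) ×ˢ (Finset.univ : Finset Bool) := by
    ext ⟨j, b⟩
    simp [Finset.mem_filter, Finset.mem_product, Finset.mem_erase]
  rw [this, Finset.card_product, Finset.card_erase_of_mem (Finset.mem_univ _), Finset.card_univ,
    Fintype.card_fin, Finset.card_univ, Fintype.card_bool]
  omega

open Classical in
/-- The admissible TURNING continuations of a memory-4 word: off the axis of the last step, and — if the word ends
with a turn — not the reverse of the second-to-last step (that would be a U-turn, class `C`). [folklore] -/
def turnCont {n : ℕ} (u : Fin (n + 3) → Fin d × Bool) : Finset (Fin d × Bool) :=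
  Finset.univ.filter fun c => c.1 ≠ (u ⟨n + 2, by omega⟩).1 ∧ (EndTurn u → c ≠ srev (u ⟨n + 1, by omega⟩))

open Classical in
/-- `#turnCont u ≥ 2d − 2` after a straight end, `≥ 2d − 3` after a turn. [folklore] -/
theorem le_card_turnCont {n : ℕ} (u : Fin (n + 3) → Fin d × Bool) :
    (if EndTurn u then 2 * d - 3 else 2 * d - 2) ≤ (turnCont u).card := by
  classical
  have hoff := card_filter_fst_ne' (d := d) (u ⟨n + 2, by omega⟩).1
  split_ifs with ht
  · have hsub : ((Finset.univ : Finset (Fin d × Bool)).filter fun a => a.1 ≠ (u ⟨n + 2, by omega⟩).1).erase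
        (srev (u ⟨n + 1, by omega⟩)) ⊆ turnCont u := by
      intro c hc
      rw [Finset.mem_erase, Finset.mem_filter] at hc
      simp only [turnCont, Finset.mem_filter, Finset.mem_univ, true_and]
      exact ⟨hc.2.2, fun _ => hc.1⟩
    have := Finset.card_le_card hsub
    have hcard := Finset.card_erase_le (s := (Finset.univ : Finset (Fin d × Bool)).filter fun a => a.1 ≠ (u ⟨n + 2, by omega⟩).1)
      (a := srev (u ⟨n + 1, by omega⟩))
    have hge : ((Finset.univ : Finset (Fin d × Bool)).filter fun a => a.1 ≠ (u ⟨n + 2, by omega⟩).1).card - 1 ≤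
        (((Finset.univ : Finset (Fin d × Bool)).filter fun a => a.1 ≠ (u ⟨n + 2, by omega⟩).1).erase
          (srev (u ⟨n + 1, by omega⟩))).card := Finset.pred_card_le_card_erase
    omega
  · have hsub : ((Finset.univ : Finset (Fin d × Bool)).filter fun a => a.1 ≠ (u ⟨n + 2, by omega⟩).1) ⊆ turnCont u := by
      intro c hc
      rw [Finset.mem_filter] at hc
      simp only [turnCont, Finset.mem_filter, Finset.mem_univ, true_and]
      exact ⟨hc.2, fun h => absurd h ht⟩
    have := Finset.card_le_card hsub
    omega

/-- **`B_{n+1} ≥ (2d−2) A_n + (2d−3) (B_n + C_n)`** (the turning continuations). [folklore] -/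
theorem le_card_endB_succ (d n : ℕ) :
    (2 * d - 2) * (endA d n).card + (2 * d - 3) * ((endB d n).card + (endC d n).card) ≤ (endB d (n + 1)).card := by
  classical
  set D := (memFourWords d (n + 3)).sigma fun u => turnCont u with hD
  have hmap : D.card ≤ (endB d (n + 1)).card := by
    refine Finset.card_le_card_of_injOn (fun p => wordSnoc p.1 p.2) (fun p hp => ?_) (fun p hp p' hp' h => ?_)
    · rw [Finset.mem_coe, hD, Finset.mem_sigma, mem_memFourWords] at hp
      obtain ⟨hu, hc⟩ := hp
      simp only [turnCont, Finset.mem_filter, Finset.mem_univ, true_and] at hc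
      obtain ⟨u, c⟩ := p
      simp only at hu hc ⊢
      have hlt : ∀ (k : ℕ) (hk : k < n + 3), wordSnoc u c ⟨k, by omega⟩ = u ⟨k, hk⟩ := fun k hk =>
        wordSnoc_apply_of_lt u c (show (⟨k, by omega⟩ : Fin (n + 3 + 1)).1 < n + 3 from hk)
      have hlast : wordSnoc u c ⟨n + 3, by omega⟩ = c := wordSnoc_last u c
      rw [Finset.mem_coe, endB, Finset.mem_filter, mem_memFourWords]
      refine ⟨isMemFour_wordSnoc hu ?_ ?_, ?_, ?_⟩
      · intro h; exact hc.1 (by rw [h]; simp [srev])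
      · rintro ⟨h1, h2⟩
        by_cases ht : EndTurn u
        · exact hc.2 ht h2
        · -- straight end: u(n+2) = u(n+1) (same axis, no reversal), so u(n+1) = srev u(n): a reversal
          unfold EndTurn at ht
          have ht' : (u ⟨n + 2, by omega⟩).1 = (u ⟨n + 1, by omega⟩).1 := not_ne_iff.mp ht
          have heq : u ⟨n + 2, by omega⟩ = u ⟨n + 1, by omega⟩ :=
            eq_of_fst_eq_of_ne_srev' ht' (hu.1 (n + 1) (by omega))
          rw [heq] at h1
          exact hu.1 n (by omega) h1
      · unfold EndTurn
        rw [show (⟨n + 1 + 2, _⟩ : Fin (n + 1 + 3)) = ⟨n + 3, by omega⟩ from rfl, hlast,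
          show (⟨n + 1 + 1, _⟩ : Fin (n + 1 + 3)) = ⟨n + 2, by omega⟩ from rfl, hlt (n + 2) (by omega)]
        exact hc.1
      · rintro ⟨h1, h2⟩
        rw [show (⟨n + 1 + 2, _⟩ : Fin (n + 1 + 3)) = ⟨n + 3, by omega⟩ from rfl, hlast, hlt (n + 1) (by omega)] at h2
        rw [show (⟨n + 1 + 1, _⟩ : Fin (n + 1 + 3)) = ⟨n + 2, by omega⟩ from rfl, hlt (n + 2) (by omega),
          hlt (n + 1) (by omega)] at h1
        exact hc.2 h1 h2
    · obtain ⟨p1, p2⟩ := p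
      obtain ⟨q1, q2⟩ := p'
      obtain ⟨h1, h2⟩ := wordSnoc_inj' h
      subst h1; subst h2; rfl
  refine le_trans ?_ hmap
  rw [hD, Finset.card_sigma, ← Finset.sum_filter_add_sum_filter_not (memFourWords d (n + 3)) (fun u => EndTurn u),
    card_endB_add_card_endC, add_comm]
  have hT : (2 * d - 3) * ((memFourWords d (n + 3)).filter fun u => EndTurn u).card ≤
      ∑ u ∈ (memFourWords d (n + 3)).filter (fun u => EndTurn u), (turnCont u).card := by
    rw [mul_comm, ← smul_eq_mul, ← Finset.sum_const]
    refine Finset.sum_le_sum fun u hu => ?_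
    rw [Finset.mem_filter] at hu
    have := le_card_turnCont u
    rw [if_pos hu.2] at this
    exact this
  have hA : (2 * d - 2) * (endA d n).card ≤
      ∑ u ∈ (memFourWords d (n + 3)).filter (fun u => ¬ EndTurn u), (turnCont u).card := by
    rw [show endA d n = (memFourWords d (n + 3)).filter (fun u => ¬ EndTurn u) from rfl, mul_comm, ← smul_eq_mul,
      ← Finset.sum_const]
    refine Finset.sum_le_sum fun u hu => ?_
    rw [Finset.mem_filter] at hu
    have := le_card_turnCont u
    rw [if_neg hu.2] at this
    exact this
  exact add_le_add hT hA

/-! ### Memory `4` (typed hierarchy) = `IsMemFour` -/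

/-- `IsMemFour` (no reversal, no unit square) implies memory `4`: sites at gaps `1, 3` differ by parity, at gap `2` by the
absence of reversals, and a gap-`4` return `e_a + e_b + e_c + e_d = 0` would make `e_a + e_b + e_c = e_{−d}` a unit step,
forcing a reversal or the unit square (`cancel_of_three_steps`). [folklore] -/
theorem isMem_four_of_isMemFour {n : ℕ} {w : Fin n → Fin d × Bool} (h : IsMemFour w) : IsMem 4 w := by
  intro i j hj hij hτ heq
  have h1 : ∀ k (hk : k < n), wordPos w (k + 1) = wordPos w k + stepVec (w ⟨k, hk⟩) := fun k hk => wordPos_succ w hk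
  rcases (by omega : j = i + 1 ∨ j = i + 2 ∨ j = i + 3 ∨ j = i + 4) with rfl | rfl | rfl | rfl
  · exact wordPos_ne_of_odd w (by omega) hj (by omega) heq
  · exact isMem_two_of_isNBW h.1 i (i + 2) hj (by omega) (by omega) heq
  · exact wordPos_ne_of_odd w (by omega) hj (by omega) heq
  · rw [show i + 4 = i + 1 + 1 + 1 + 1 from rfl, h1 (i + 3) (by omega), h1 (i + 2) (by omega), h1 (i + 1) (by omega),
      h1 i (by omega)] at heq
    have h0 : stepVec (w ⟨i, by omega⟩) + stepVec (w ⟨i + 1, by omega⟩) + stepVec (w ⟨i + 2, by omega⟩) +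
        stepVec (w ⟨i + 3, by omega⟩) = 0 := by
      have := heq.symm
      rw [add_assoc, add_assoc, add_assoc] at this
      have h' := left_eq_add.mp this.symm
      rw [← add_assoc, ← add_assoc] at h'
      exact h'
    have h3 : stepVec (w ⟨i, by omega⟩) + stepVec (w ⟨i + 1, by omega⟩) + stepVec (w ⟨i + 2, by omega⟩) =
        stepVec (srev (w ⟨i + 3, by omega⟩)) := by
      rw [stepVec_srev]; exact eq_neg_of_add_eq_zero_left h0
    rcases cancel_of_three_steps h3 with hc | hc | hc
    · exact h.1 i (by omega) hc
    · exact h.1 (i + 1) (by omega) hc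
    · -- `c = −a`: then `e_b + e_d = 0`, `d = −b`: the unit square
      have hbd : stepVec (w ⟨i + 1, by omega⟩) + stepVec (w ⟨i + 3, by omega⟩) = 0 := by
        have : stepVec (w ⟨i + 2, by omega⟩) = -stepVec (w ⟨i, by omega⟩) := by rw [hc, stepVec_srev]
        rw [this] at h0
        have e : stepVec (w ⟨i, by omega⟩) + stepVec (w ⟨i + 1, by omega⟩) + -stepVec (w ⟨i, by omega⟩) +
            stepVec (w ⟨i + 3, by omega⟩) = stepVec (w ⟨i + 1, by omega⟩) + stepVec (w ⟨i + 3, by omega⟩) := by abel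
        rw [e] at h0; exact h0
      have hd : stepVec (w ⟨i + 3, by omega⟩) = stepVec (srev (w ⟨i + 1, by omega⟩)) := by
        rw [stepVec_srev]; exact eq_neg_of_add_eq_zero_right hbd
      exact h.2 i (by omega) ⟨hc, GMStep.stepVec_injective d hd⟩

/-- `memWords d 4 n = memFourWords d n`. [cite: MadrasSlade1993, §1.2 (1.2.14)] -/
theorem memWords_four_eq_memFourWords (d n : ℕ) : memWords d 4 n = memFourWords d n := by
  classical
  ext w
  rw [mem_memWords, mem_memFourWords]
  exact ⟨isMemFour_of_isMem_four, isMem_four_of_isMemFour⟩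

/-- `c_{n,4} = #memFourWords d n`. [cite: MadrasSlade1993, §1.2 (1.2.14)] -/
theorem memCount_four_eq (d n : ℕ) : memCount d 4 n = (memFourWords d n).card := by
  unfold memCount; rw [memWords_four_eq_memFourWords]

end Summit.CriticalPhenomena.PercolationContinuityZ3.Theorems.Pcint.MemoryTail
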